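import Literature.NumberTheory.EllipticCurves.BigRepModuleShapiroSurjectiveProofs
import Literature.NumberTheory.EllipticCurves.Kato2004.IwasawaH1Reduction
import Literature.NumberTheory.EllipticCurves.GaloisAction
import Literature.GroupTheory.PadicQuotientSectionProofs
import HarnessLib

/-!
# Shapiro's lemma for the co-induced module, CLASS LEVEL: `H¹(G, A ⊗ Λ^*(Ψ⁻¹)) ≃+ H¹(ker κ, A)` by
# `[c] ↦ [h ↦ c(h)(0)]`, for a profinite `G`, `κ : G ↠ ℤ_p`, discrete `p`-primary `A` — PROVED

Topic `Literature/NumberTheory/EllipticCurves`. Theorems only: no definition, no named fact, no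
`sorry`, no instance, no notation. Cell `bsd-stepL`, seat `bsd-stepL-imc-p1` (g11): module M5a
(assembly, group-cohomology part) of the tree-mapped discharge plan
`NOTE-prop323-Shapiro-discharge-plan-imc-p1-g11` for `SkinnerUrban2014.prop323_XAc_equiv_XBigDecomp`
([SU14] Prop. 3.2.3). It packages M1 (`BigRepModuleShapiroInjectiveProofs`: injectivity), M2a
(`BigRepModuleShapiroSurjectiveProofs`: surjectivity from a section) and M2b
(`Literature.GroupTheory.exists_continuousMonoidHom_section_padicInt`: the section exists for compact
totally disconnected `G`) into ONE additive equivalence between Mathlib's continuous cohomology groups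

  `continuousCohomology 1 (bigRep κ ρ).toTopRep  ≃+  subgroupH1 H A = continuousCohomology 1 (discreteTopRep H A)`,

`H = ker κ`, characterised on cocycles by `e [c] = [h ↦ c(h)(0)]` — the two sides being exactly the
`H¹`'s in which the tree's `BigGaloisRep.selmerBigDecomp` (RIGHT side of the fact, over `Λ_𝒪 = 𝒪⟦T⟧`)
and `Castella2018.AcSelmer.selmerAc` (LEFT side, the tree's `subgroupH1` over `ℤ`) live. The map is
built with the tree's `liftH1AddHom` (universal property of `H¹` on explicit cocycles,
`Kato2004/IwasawaH1Reduction.lean`); no `def` is introduced (the equivalence is produced as `∃ e, …`).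

What is left for `prop323_…_holds` (modules M3c/M5b of the plan): transporting the SELMER CONDITIONS
through `e` (local criteria M3a/M3b: `BigRepModuleShapiroLocalSplitProofs`, `…OpenImageProofs`; case
split `Literature.GroupTheory.kappa_eq_one_or_exists_image_eq_span_pow`), `CharacterModule` duality and
the `Λ`-linearity (orientation lemma M4, `BigRepModuleShapiroEquivariantProofs`).

HONEST FRAMING: group cohomology; nothing about elliptic curves or BSD; the named fact is NOT discharged
by this file.

References: [SkinnerUrban2014] §3.1.1–3.1.2, Prop. 3.2.3; [SerreGaloisCohomology1997] I §2.5;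
[NeukirchSchmidtWingberg2008] (1.6.4).
-/

noncomputable section

open Multiplicative Topology
open Literature.NumberTheory.GaloisRepresentations

namespace Literature.NumberTheory.EllipticCurves.BigRepModule

universe u

variable {𝒪 : Type*} [CommRing 𝒪] {p : ℕ} [hp : Fact p.Prime] {A : Type u} [AddCommGroup A] [Module 𝒪 A]
  [TopologicalSpace 𝒪] [TopologicalSpace A] [DiscreteTopology A]
  {G : Type u} [Group G] [TopologicalSpace G] [IsTopologicalGroup G] [CompactSpace G]
  [TotallyDisconnectedSpace G] [DistribMulAction G A]
  [TopologicalSpace (PowerSeries 𝒪)] [ContinuousSMul (PowerSeries 𝒪) (BigRepModule 𝒪 p A)]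

/-- **SHAPIRO'S LEMMA ON `H¹`, co-induced model.** Let `G` be a compact totally disconnected topological
group, `κ : G → ℤ_p` a continuous homomorphism hitting `1` (`κ γ = 1`), `H ≤ G` its kernel, `A` a
discrete `p`-primary `G`-module whose action is the continuous `𝒪`-linear representation `ρ`
(`ρ g a = g • a`). Then there is an additive equivalence
`e : H¹(G, M) ≃+ H¹(H, A)`, `M = BigRepModule 𝒪 p A` with `bigRep κ ρ`, such that for every continuous
cocycle `c` of `M` and every continuous cocycle `z` of `A` on `H` with `z(h) = c(h)(0)`:
`e [c] = [z]` (Shapiro's map = restriction to `H` followed by evaluation at `0 ∈ Γ`).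
[cite: SkinnerUrban2014, Prop. 3.2.3 ("`H¹(F_∞, T ⊗_A A^*) = … = H¹(F, T ⊗_A Λ^*_{F,A}(ε_F⁻¹))`")]
[cite: SerreGaloisCohomology1997, I §2.5 (Shapiro's lemma)] -/
theorem exists_addEquiv_h1_shapiro (κ : G →ₜ* Multiplicative ℤ_[p]) (ρ : ContinuousRep G 𝒪 A)
    (hρ : ∀ (g : G) (a : A), ρ g a = g • a) (hA : ∀ a : A, ∃ k : ℕ, p ^ k • a = 0)
    (H : Subgroup G) (hH : ∀ g : G, g ∈ H ↔ κ g = 1) (γ : G) (hγ : κ γ = ofAdd 1) :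
    ∃ e : continuousCohomology 1 (bigRep κ ρ).toTopRep ≃+ subgroupH1 H A,
      ∀ (c : contOneCocycles (bigRep κ ρ).toTopRep) (z : contOneCocycles (discreteTopRep H A)),
        (∀ h : H, z.1 h = (c.1 (h : G) : BigRepModule 𝒪 p A) 0) →
          e (oneCocycleClass _ c) = oneCocycleClass _ z := by
  classical
  -- a continuous homomorphic section of `κ` (M2b) and surjectivity of `κ`
  obtain ⟨σ, hσ⟩ := Literature.GroupTheory.exists_continuousMonoidHom_section_padicInt κ γ hγ
  have hκ : Function.Surjective κ := fun y ↦ ⟨σ y, hσ y⟩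
  -- ### Shapiro's map on cocycles: `c ↦ (h ↦ c(h)(0))`
  let X : TopRep (PowerSeries 𝒪) G := (bigRep κ ρ).toTopRep
  let Y : TopRep ℤ H := discreteTopRep H A
  have hYρ : ∀ (h : H) (a : A), Y.ρ h a = ρ (h : G) a := fun h a ↦ by
    rw [hρ]; rfl
  let sh : contOneCocycles X →+ contOneCocycles Y :=
    { toFun := fun c ↦ ⟨⟨fun h : H ↦ (c.1 (h : G) : BigRepModule 𝒪 p A) 0,
        (continuous_of_discreteTopology (f := fun Φ : BigRepModule 𝒪 p A ↦ Φ 0)).comp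
          (c.1.continuous.comp continuous_subtype_val)⟩, fun h₁ h₂ ↦ by
        change (c.1 ((h₁ : G) * h₂) : BigRepModule 𝒪 p A) 0 =
          (c.1 (h₁ : G) : BigRepModule 𝒪 p A) 0 + Y.ρ h₁ ((c.1 (h₂ : G) : BigRepModule 𝒪 p A) 0)
        rw [hYρ]
        exact apply_zero_cocycle κ ρ (c := fun g ↦ (c.1 g : BigRepModule 𝒪 p A))
          (fun g h ↦ c.2 g h) ((hH _).1 h₁.2) h₂⟩
      map_zero' := Subtype.ext (ContinuousMap.ext fun _ ↦ rfl)
      map_add' := fun _ _ ↦ Subtype.ext (ContinuousMap.ext fun _ ↦ rfl) }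
  have hsh : ∀ (c : contOneCocycles X) (h : H), (sh c).1 h = (c.1 (h : G) : BigRepModule 𝒪 p A) 0 :=
    fun _ _ ↦ rfl
  -- it kills coboundaries, hence descends to `H¹`
  have hdesc : ∀ c : contOneCocycles X, oneCocycleClass X c = 0 →
      ((oneCocycleClassₗ Y).toAddMonoidHom.comp sh) c = 0 := by
    intro c hc
    obtain ⟨Φ, hΦ⟩ := (oneCocycleClass_eq_zero_iff X c).1 hc
    change oneCocycleClass Y (sh c) = 0
    rw [oneCocycleClass_eq_zero_iff]
    refine ⟨(Φ : BigRepModule 𝒪 p A) 0, fun h ↦ ?_⟩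
    rw [hsh, hΦ, hYρ]
    exact bigRep_sub_apply_zero κ ρ Φ ((hH _).1 h.2)
  let F : continuousCohomology 1 X →+ subgroupH1 H A :=
    liftH1AddHom X ((oneCocycleClassₗ Y).toAddMonoidHom.comp sh) hdesc
  have hF : ∀ c : contOneCocycles X, F (oneCocycleClass X c) = oneCocycleClass Y (sh c) := fun c ↦
    liftH1AddHom_oneCocycleClass X _ hdesc c
  -- ### injective (M1) and surjective (M2a with the section σ)
  have hinj : Function.Injective F := by
    refine (injective_iff_map_eq_zero F).2 fun ξ hξ ↦ ?_
    obtain ⟨c, rfl⟩ := oneCocycleClass_surjective X ξ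
    rw [hF, oneCocycleClass_eq_zero_iff] at hξ
    obtain ⟨a, ha⟩ := hξ
    refine oneCocycleClass_eq_zero_of_apply_zero_eq (κ := κ) (ρ := ρ) hκ hA c (a := a) fun h hh ↦ ?_
    have := ha ⟨h, (hH h).2 hh⟩
    rw [hsh, hYρ] at this
    exact this
  have hsurj : Function.Surjective F := by
    intro ξ
    obtain ⟨z, rfl⟩ := oneCocycleClass_surjective Y ξ
    obtain ⟨c, hcont, hc, hcz⟩ := exists_cocycle_apply_zero_eq (κ := κ) (ρ := ρ) (σ := σ) hσ hA hH
      (fun h : H ↦ z.1 h) z.1.continuous (fun h₁ h₂ ↦ by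
        have := z.2 h₁ h₂
        rw [hYρ] at this
        exact this)
    refine ⟨oneCocycleClass X ⟨⟨c, hcont⟩, fun g h ↦ hc g h⟩, ?_⟩
    rw [hF]
    exact congrArg _ (Subtype.ext (ContinuousMap.ext fun h ↦ hcz h))
  refine ⟨AddEquiv.ofBijective F ⟨hinj, hsurj⟩, fun c z hz ↦ ?_⟩
  rw [AddEquiv.ofBijective_apply, hF]
  exact congrArg _ (Subtype.ext (ContinuousMap.ext fun h ↦ (hz h).symm))

end Literature.NumberTheory.EllipticCurves.BigRepModule

end
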